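import Mathlib.Analysis.SpecialFunctions.SmoothTransition
import Mathlib.Analysis.InnerProductSpace.Laplacian
import Literature.Analysis.FluidPDE.SereginZajaczkowski2007L42
import Literature.Analysis.FluidPDE.SerrinEnstrophyGronwall
import HarnessLib

/-!
# Seregin–Zajaczkowski 2007: the vorticity half of Lemma 4.2, decomposed

G. Seregin, W. Zajaczkowski, *A sufficient condition of regularity for axially symmetric
solutions to the Navier–Stokes equations*, SIAM J. Math. Anal. 39 (2007) 669–685 =
arXiv:math/0702720 (numbers are those of the arXiv version, §4). The sibling file
`SereginZajaczkowski2007L42.lean` vendors the first half of the printed proof of Lemma 4.2 as the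
named fact `OffAxisVorticityL2Bound`:
`sup_{-(15/8)² < t < 0} ∫_{𝒞½} |ω_φ(x,t)|² dx ≤ Φ₃(𝒜₂)` for the class
`IsSmoothAxisymmetricSolutionOn Q̃ V P` of Prop. 4.1, `Q̃ = 𝒞(1/4, 3; 2) × ]-2², 0[`,
`𝒞½ = 𝒞(9/32, 23/8; 15/8)`. That half of the proof (arXiv pp. 5–6) consists of

1. the identities (4.3) `V_{ϱ,ϱ} + V_{3,3} = -V_ϱ/ϱ`, (4.4) `V_{ϱ,3} - V_{3,ϱ} = χ` (`χ = ω_φ`) and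
   **the equation (4.5) for `χ`**,
   `∂_t χ + V_ϱ χ_{,ϱ} + V₃ χ_{,3} - (1/ϱ) χ V_ϱ - (χ_{,ϱϱ} + χ_{,33} + (1/ϱ) χ_{,ϱ} - χ/ϱ²)
     = (2/ϱ) V_φ V_{φ,3}`;
2. a cut-off: "a non-negative smooth and axially symmetric cut-off function `ψ` vanishes in a
   neighborhood of the parabolic boundary of `Q̃` and is equal to `1` in `Q̃₁`"; the equation
   (4.8) for `χ̃ = χψ` with right-hand side `J₁ + J₂ + J₃`; **the energy identity (4.9)** for
   `χ̃/ϱ` ("we multiply (4.8) by `χ̃ϱ⁻²` and integrate the product by parts over `𝒞̃`"), the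
   estimates (4.10)–(4.12) of the three terms (integration by parts in `x₃`, Hölder, and
   Ladyzhenskaya's inequality in the variables `(ϱ, x₃)` three times), and Young's inequality,
   giving **the final inequality (4.13)**
   `∂_t ∫_𝒞̃ |χ̃/ϱ|² dx + ∫_𝒞̃ |∇_a(χ̃/ϱ)|² dx
      ≤ c ∫_𝒞̃ |∇V|² dx + (𝒜₂² + 𝒜₂ ∫_𝒞̃ |∇V|² dx)(∫_𝒞̃ |χ̃/ϱ|² dx + 1)`;
3. the sentence "Estimate (4.13) implies `‖χ̃‖_{L_{2,∞}(Q̃)} ≤ Φ₃(𝒜₂)`" (Gronwall's lemma: the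
   kernel `∫_𝒞̃ |∇V(·,t)|² dx` is integrable in time with integral `≤ 𝒜₂`, and `χ̃ = 0` near
   `t = -2²`).

This file vendors steps 1 and 2 as named facts and PROVES step 3 from them:

* `AngularVorticityEquation` (step 1): for the class of Prop. 4.1 on `Q̃`, the angular vorticity
  `χ(t, x) = ω_φ = angularVorticity (V t) x` has a continuous time derivative on `Q̃` and satisfies
  (4.5) at every point of `Q̃` (hypothesis structure `AngularVorticityEqOn`, which also records the
  continuity on `Q̃` of `χ`, `D_x χ`, `Δ_x χ` used by the energy method);
* `LocalizedVorticityEnergyInequality` (step 2): for every cut-off `ψ` as quoted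
  (`IsLemma42Cutoff`, with `Q̃₁` replaced by the intermediate cylinder `Q̃½` of the sibling file)
  there is a constant `C` such that, for the class together with (4.5) and `𝒜₂ ≤ K`, the function
  `y(t) = ∫_𝒞̃ |χ̃/ϱ|² dx` (`vortEnergy`) is bounded on `[-2², T]`, `T < 0`, and obeys (4.13) in
  integrated form, `y(t) ≤ ∫_{-2²}^{t} C (1+K)² (1 + ∫_𝒞̃ |∇V(·,s)|² dx)(1 + y(s)) ds`;
* `offAxisVorticityL2Bound_of` (step 3, proved):
  `AngularVorticityEquation → LocalizedVorticityEnergyInequality → OffAxisVorticityL2Bound`, with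
  `Φ₃(K) = 9 exp (C (1+K)² (4+K))`: an explicit cut-off `lemma42Cutoff` is fed to step 2,
  Grönwall's lemma with an `L¹` kernel (accepted `lintegral_gronwall_le`, here shifted to a general
  time interval, `lintegral_gronwall_le_of_Icc`) bounds `1 + y ≤ exp (∫ C(1+K)²(1 + ∫_𝒞̃|∇V|²))`,
  Tonelli gives `∫_{-2²}^{0} ∫_𝒞̃ |∇V|² = ∫_Q̃ |∇V|² ≤ 𝒜₂ ≤ K`, and on `Q̃½` one has `ψ = 1` and
  `ϱ < 3`, so `∫_{𝒞½} |ω_φ|² ≤ 9 y(t)`.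

## Rendering choices

* (4.5) is rendered in Cartesian form: for the axially symmetric scalar `χ` one has, off the
  axis, `V_ϱ χ_{,ϱ} + V₃ χ_{,3} = Dχ · V` (the derivative of `χ` along `e_φ` vanishes) and
  `χ_{,ϱϱ} + χ_{,33} + (1/ϱ) χ_{,ϱ} = Δχ`, so (4.5) reads
  `∂_t χ + Dχ·V - V_ϱ χ/ϱ - Δχ + χ/ϱ² = (2/ϱ) V_φ ∂₃V_φ`, with `∂_t` the accepted `timeDeriv`,
  `Δ` Mathlib's Laplacian, `V_ϱ, V_φ` the accepted `radialVelocity`, `swirlVelocity`, and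
  `∂₃V_φ = D(V_φ)(e₃)`. The paper writes (4.5) for "sufficiently smooth" solutions; that it holds
  CLASSICALLY (with a genuine time derivative) for the class of Prop. 4.1 — suitable weak solutions
  smooth in `x` with all spatial derivatives Hölder continuous in space–time, no time derivative
  assumed — is part of the content of the fact (the distributional vorticity equation
  `∂_t ω = Δω - curl ((V·∇)V)` on `Q̃` has a continuous right-hand side, whence `ω` is `C¹` in `t`).
* (4.13) is rendered in integrated form on `]-2², t[` (the printed `χ̃` vanishes near `t = -2²`),
  with the dissipation `∫|∇_a(χ̃/ϱ)|²` dropped from the left-hand side and the kernel in the form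
  `C(1+K)²(1 + ∫_𝒞̃|∇V(·,s)|²dx)(1 + y(s))`, which dominates the printed
  `c∫|∇V|² + (𝒜₂² + 𝒜₂∫|∇V|²)(y + 1)` (a conclusion weaker than the print; it is all step 3
  uses). The boundedness of `y` on `[-2², T]` (it is continuous and vanishes near `-2²`) is recorded
  because it is what makes Grönwall's lemma applicable. `|∇V|²` is the squared Frobenius norm of
  the classical gradient, as in `𝒜₂ = szEnergy V P (D_x V)`.
* The cut-off class `IsLemma42Cutoff` renders the quoted sentence with `Q̃₁` replaced by `Q̃½`
  (the sibling file's intermediate cylinder): smooth on `ℝ × ℝ³`, values in `[0, 1]`, axially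
  symmetric slices, equal to `1` on `Q̃½`, and vanishing outside `[t₀, ∞[ × K₀` for a compact
  `K₀ ⊂ 𝒞̃` and a `t₀ ∈ ]-2², -(15/8)²[` ("vanishes in a neighborhood of the parabolic boundary").
  Step 2 is stated for EVERY such cut-off (the printed argument uses nothing else about `ψ`).

## Not here

The discharges of the two facts (the plan is in the module docstrings of their future proof
files): `AngularVorticityEquation` needs the distributional vorticity equation for the class, the
time-regularity bootstrap and the cylindrical-coordinate form of the `e_φ`-component of
`Δω - curl((V·∇)V)`; `LocalizedVorticityEnergyInequality` needs the energy identity (4.9) and the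
estimates (4.10)–(4.12) (Ladyzhenskaya's inequality on shells is the accepted
`exists_axisym_ladyzhenskaya_const`).

## References

* G. Seregin, W. Zajaczkowski, SIAM J. Math. Anal. 39 (2007) 669–685, arXiv:math/0702720, §4:
  proof of Lemma 4.2, (4.3)–(4.13) and the sentence "Estimate (4.13) implies
  `‖χ̃‖_{L_{2,∞}(Q̃)} ≤ Φ₃(𝒜₂)`" (arXiv pp. 5–6). [`SereginZajaczkowski2007`]
* J. C. Robinson, J. L. Rodrigo, W. Sadowski, *The three-dimensional Navier–Stokes equations*,
  CUP 2016, Lemma A.25 (Grönwall with an `L¹` kernel; accepted `lintegral_gronwall_le`).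
  [`RobinsonRodrigoSadowski2016`]
-/

noncomputable section

open MeasureTheory Set Function Filter Topology TopologicalSpace Metric WithLp
open scoped NNReal ENNReal ContDiff InnerProductSpace RealInnerProductSpace Laplacian

namespace Literature.Analysis.FluidPDE

namespace SereginZajaczkowski2007

open SereginSverak2009

/-- Local notation for physical space `ℝ³ = EuclideanSpace ℝ (Fin 3)`. -/
local notation "ℝ³" => EuclideanSpace ℝ (Fin 3)

/-! ### Step 1: the equation (4.5) for the angular vorticity -/

/-- **The angular-vorticity equation (4.5), holding classically on an open space–time set `S`.**
For a velocity field `V`, write `χ(t, x) = ω_φ = angularVorticity (V t) x` (accepted). The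
structure records: `χ`, its spatial gradient `D_x χ` and its spatial Laplacian `Δ_x χ` are
continuous on `S` in space–time and every slice `χ(t, ·)` is `C²` at the points of `S`; `χ` is
differentiable in `t` at every point of `S` with `∂_t χ` (accepted `timeDeriv`) continuous on `S`;
and at every `(t, x) ∈ S`
`∂_t χ + Dχ·V - V_ϱ χ/ϱ - Δχ + χ/ϱ² = (2/ϱ) V_φ ∂₃V_φ`,
which is Seregin–Zajaczkowski's (4.5)
`∂_t χ + V_ϱ χ_{,ϱ} + V₃ χ_{,3} - (1/ϱ) χ V_ϱ - (χ_{,ϱϱ} + χ_{,33} + (1/ϱ)χ_{,ϱ} - χ/ϱ²) = (2/ϱ) V_φ V_{φ,3}`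
in Cartesian form (module docstring: for the axially symmetric scalar `χ`,
`V_ϱ χ_{,ϱ} + V₃ χ_{,3} = Dχ·V` and `χ_{,ϱϱ} + χ_{,33} + χ_{,ϱ}/ϱ = Δχ` off the axis), with
`V_ϱ = radialVelocity`, `V_φ = swirlVelocity` (accepted) and `∂₃V_φ = D(V_φ)(e₃)`. A hypothesis
structure; nothing is asserted. [cite: SereginZajaczkowski2007, proof of Lemma 4.2, (4.5)] -/
structure AngularVorticityEqOn (S : Opens (ℝ × ℝ³)) (V : ℝ → ℝ³ → ℝ³) : Prop where
  /-- `χ` is continuous on `S`. -/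
  continuousOn :
    ContinuousOn (fun z : ℝ × ℝ³ => angularVorticity (V z.1) z.2) (S : Set (ℝ × ℝ³))
  /-- every slice `χ(t, ·)` is `C²` at the points of `S`. -/
  contDiffAt : ∀ z ∈ (S : Set (ℝ × ℝ³)), ContDiffAt ℝ 2 (fun y => angularVorticity (V z.1) y) z.2
  /-- `D_x χ` is continuous on `S`. -/
  continuousOn_fderiv : ContinuousOn
    (fun z : ℝ × ℝ³ => fderiv ℝ (fun y => angularVorticity (V z.1) y) z.2) (S : Set (ℝ × ℝ³))
  /-- `Δ_x χ` is continuous on `S`. -/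
  continuousOn_laplacian : ContinuousOn
    (fun z : ℝ × ℝ³ => (Δ fun y => angularVorticity (V z.1) y) z.2) (S : Set (ℝ × ℝ³))
  /-- `χ(·, x)` is differentiable in time at every point of `S`. -/
  differentiableAt_time : ∀ z ∈ (S : Set (ℝ × ℝ³)),
    DifferentiableAt ℝ (fun s => angularVorticity (V s) z.2) z.1
  /-- `∂_t χ` is continuous on `S`. -/
  continuousOn_timeDeriv : ContinuousOn
    (fun z : ℝ × ℝ³ => timeDeriv (fun t x => angularVorticity (V t) x) z.1 z.2) (S : Set (ℝ × ℝ³))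
  /-- the equation (4.5) at every point of `S`. -/
  eq : ∀ z ∈ (S : Set (ℝ × ℝ³)),
    timeDeriv (fun t x => angularVorticity (V t) x) z.1 z.2 +
          fderiv ℝ (fun y => angularVorticity (V z.1) y) z.2 (V z.1 z.2) -
        radialVelocity (V z.1) z.2 * angularVorticity (V z.1) z.2 / cylRadius z.2 -
      (Δ fun y => angularVorticity (V z.1) y) z.2 +
    angularVorticity (V z.1) z.2 / cylRadius z.2 ^ 2 =
      2 / cylRadius z.2 * swirlVelocity (V z.1) z.2 *
        fderiv ℝ (fun y => swirlVelocity (V z.1) y) z.2 eZ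

/-- **Seregin–Zajaczkowski 2007, proof of Lemma 4.2, the equation (4.5) for `χ = ω_φ`.** "Let us
denote by `ω` the vorticity of `v`, i.e., `ω = ∇ ∧ v`. For `χ = ω_φ`, `V_ϱ`, and `V₃`, we have the
following identities: `V_{ϱ,ϱ} + V_{3,3} = -(1/ϱ) V_ϱ` (4.3), `V_{ϱ,3} - V_{3,ϱ} = χ` (4.4),
`∂_t χ + V_ϱ χ_{,ϱ} + V₃ χ_{,3} - (1/ϱ) χ V_ϱ - (χ_{,ϱϱ} + χ_{,33} + (1/ϱ) χ_{,ϱ} - χ/ϱ²)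
  = (2/ϱ) V_φ V_{φ,3}` (4.5)", under the assumptions of Prop. 4.1 ("`V` and `P` [are] a
sufficiently smooth axially symmetric solution to the Navier–Stokes equations in
`Q̃ = 𝒞̃ × ]-2², 0[`, `𝒞̃ = 𝒞(1/4, 3; 2)`"). Rendered (module docstring): for the accepted class
`IsSmoothAxisymmetricSolutionOn Q̃ V P` (suitable weak solution, axially symmetric, smooth in `x`
with all spatial derivatives Hölder continuous in space–time), (4.5) holds CLASSICALLY at every
point of `Q̃`, in the Cartesian form and with the regularity recorded in `AngularVorticityEqOn`
(it is the `e_φ`-component of the vorticity equation `∂_t ω + (V·∇)ω - (ω·∇)V = Δω`, which the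
class satisfies in `𝒟'(Q̃)` with continuous right-hand side, hence classically).
[cite: SereginZajaczkowski2007, proof of Lemma 4.2, (4.3)–(4.5)] -/
def AngularVorticityEquation : Prop :=
  ∀ (V : ℝ → ℝ³ → ℝ³) (P : ℝ → ℝ³ → ℝ),
    IsSmoothAxisymmetricSolutionOn (shellCylOpens (1 / 4) 3 2 2) V P →
      AngularVorticityEqOn (shellCylOpens (1 / 4) 3 2 2) V

/-! ### Step 2: the cut-offs and the final inequality (4.13) -/

/-- **The cut-offs of the proof of Lemma 4.2**: "a non-negative smooth and axially symmetric
cut-off function `ψ` [which] vanishes in a neighborhood of the parabolic boundary of `Q̃` and is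
equal to `1` in `Q̃₁`", rendered (module docstring) with `Q̃₁` replaced by the intermediate cylinder
`Q̃½ = 𝒞(9/32, 23/8; 15/8) × ]-(15/8)², 0[` of the sibling file: `ψ : ℝ → ℝ³ → ℝ` is smooth on
`ℝ × ℝ³`, takes values in `[0, 1]`, every slice `ψ(t, ·)` is an axially symmetric scalar, `ψ = 1`
on `Q̃½`, and there are a compact `K₀ ⊂ 𝒞̃ = 𝒞(1/4, 3; 2)` and a time `t₀ ∈ ]-2², -(15/8)²[` such
that `ψ(t, x) = 0` whenever `x ∉ K₀` or `t ≤ t₀`.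
[cite: SereginZajaczkowski2007, proof of Lemma 4.2 (the cut-off ψ)] -/
structure IsLemma42Cutoff (ψ : ℝ → ℝ³ → ℝ) : Prop where
  /-- `ψ` is smooth on `ℝ × ℝ³`. -/
  contDiff : ContDiff ℝ ∞ (uncurry ψ)
  /-- `0 ≤ ψ`. -/
  nonneg : ∀ t x, 0 ≤ ψ t x
  /-- `ψ ≤ 1`. -/
  le_one : ∀ t x, ψ t x ≤ 1
  /-- every slice is axially symmetric. -/
  isAxisymmetricScalar : ∀ t, IsAxisymmetricScalar (ψ t)
  /-- `ψ = 1` on `Q̃½`. -/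
  eq_one : ∀ z ∈ shellCyl (9 / 32) (23 / 8) (15 / 8) (15 / 8), ψ z.1 z.2 = 1
  /-- `ψ` vanishes near the parabolic boundary of `Q̃`: off a compact `K₀ ⊂ 𝒞̃` and before a
  time `t₀ > -2²`. -/
  support : ∃ K₀ : Set ℝ³, IsCompact K₀ ∧ K₀ ⊆ shell (1 / 4) 3 2 ∧
    ∃ t₀ ∈ Ioo (-(2 : ℝ) ^ 2) (-(15 / 8 : ℝ) ^ 2), ∀ t x, (x ∉ K₀ ∨ t ≤ t₀) → ψ t x = 0

/-- The localized weighted enstrophy `y(t) = ∫_𝒞̃ |χ̃/ϱ|² dx = ∫_𝒞̃ |χ(t,x) ψ(t,x)/ϱ|² dx` of the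
proof of Lemma 4.2 (`χ = ω_φ = angularVorticity (V t) x`, `χ̃ = χψ`, `ϱ = cylRadius x`), in
`ℝ≥0∞`. [cite: SereginZajaczkowski2007, proof of Lemma 4.2, (4.9) and (4.13) (the quantity ∫|χ̃/ϱ|²)] -/
def vortEnergy (ψ : ℝ → ℝ³ → ℝ) (V : ℝ → ℝ³ → ℝ³) (t : ℝ) : ℝ≥0∞ :=
  ∫⁻ x in shell (1 / 4) 3 2, ‖angularVorticity (V t) x * ψ t x / cylRadius x‖ₑ ^ 2

/-- The kernel `∫_𝒞̃ |∇V(x, t)|² dx` of (4.13) (squared Frobenius norm of the classical spatial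
gradient, as in `𝒜₂ = szEnergy V P (D_x V)`), in `ℝ≥0∞`.
[cite: SereginZajaczkowski2007, proof of Lemma 4.2, (4.13) (the quantity ∫|∇V|²)] -/
def shellGradEnergy (V : ℝ → ℝ³ → ℝ³) (t : ℝ) : ℝ≥0∞ :=
  ∫⁻ x in shell (1 / 4) 3 2, ENNReal.ofReal (frobeniusNormSq (fderiv ℝ (V t) x))

/-- **Seregin–Zajaczkowski 2007, proof of Lemma 4.2, the final inequality (4.13).** With a cut-off
`ψ` as in `IsLemma42Cutoff` and `χ̃ = χψ`, `χ = ω_φ` obeying (4.5): "we multiply (4.8) by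
`χ̃ϱ⁻²` and integrate the product by parts over `𝒞̃`:
`½ ∂_t ∫_𝒞̃ |χ̃/ϱ|² dx + ∫_𝒞̃ (|(χ̃/ϱ)_{,ϱ}|² + |(χ̃/ϱ)_{,3}|²) dx = ∫_𝒞̃ (J₁ + J₂ + J₃) χ̃/ϱ² dx`
(4.9) […] Combining estimates (4.9)–(4.12) and applying Young's inequality, we arrive at the final
inequality `∂_t ∫_𝒞̃ |χ̃/ϱ|² dx + ∫_𝒞̃ |∇_a(χ̃/ϱ)|² dx ≤ c ∫_𝒞̃ |∇V|² dx
  + (𝒜₂² + 𝒜₂ ∫_𝒞̃ |∇V|² dx)(∫_𝒞̃ |χ̃/ϱ|² dx + 1)` (4.13)" (the estimates (4.10)–(4.12) use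
integration by parts in `x₃`, Hölder's inequality and Ladyzhenskaya's inequality in the variables
`(ϱ, x₃)`). Rendered (module docstring): for EVERY cut-off `ψ` of the class `IsLemma42Cutoff`
there is `C ≥ 0` such that for the class `IsSmoothAxisymmetricSolutionOn Q̃ V P` of Prop. 4.1,
the equation (4.5) in the form `AngularVorticityEqOn Q̃ V`, and `𝒜₂ = szEnergy V P (D_x V) ≤ K`:
the function `y = vortEnergy ψ V` (`= ∫_𝒞̃ |χ̃/ϱ|²`) is bounded on `[-2², T]` for every `T < 0`,
and (4.13) holds integrated over `]-2², t[`, `-2² < t < 0`, with the dissipation term dropped and the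
kernel dominated: `y(t) ≤ ∫_{-2²}^{t} C (1 + K)² (1 + ∫_𝒞̃ |∇V(·,s)|² dx)(1 + y(s)) ds`
(`shellGradEnergy V s = ∫_𝒞̃ |∇V(·,s)|² dx`).
[cite: SereginZajaczkowski2007, proof of Lemma 4.2, (4.6)–(4.13)] -/
def LocalizedVorticityEnergyInequality : Prop :=
  ∀ ψ : ℝ → ℝ³ → ℝ, IsLemma42Cutoff ψ → ∃ C : ℝ≥0,
    ∀ (V : ℝ → ℝ³ → ℝ³) (P : ℝ → ℝ³ → ℝ),
      IsSmoothAxisymmetricSolutionOn (shellCylOpens (1 / 4) 3 2 2) V P →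
      AngularVorticityEqOn (shellCylOpens (1 / 4) 3 2 2) V →
      ∀ K : ℝ≥0, szEnergy V P (fun t x => fderiv ℝ (V t) x) ≤ K →
        (∀ T ∈ Ioo (-(2 : ℝ) ^ 2) 0, ∃ M : ℝ≥0, ∀ t ∈ Icc (-(2 : ℝ) ^ 2) T, vortEnergy ψ V t ≤ M) ∧
        ∀ t ∈ Ioo (-(2 : ℝ) ^ 2) 0,
          vortEnergy ψ V t ≤ ∫⁻ s in Ioo (-(2 : ℝ) ^ 2) t,
            (C : ℝ≥0∞) * (1 + K) ^ 2 * (1 + shellGradEnergy V s) * (1 + vortEnergy ψ V s)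

/-! ### An explicit cut-off -/

/-- **An explicit cut-off of the class `IsLemma42Cutoff`**: with Mathlib's smooth transition
`S = Real.smoothTransition` (`S = 0` on `]-∞, 0]`, `S = 1` on `[1, ∞[`),
`ψ(t, x) = S(5t + 75/4) · S((1024ϱ² - 72)/9) · S((560 - 64ϱ²)/31) · S((961 - 256x₃²)/61)`,
`ϱ = cylRadius x`: a product of smooth functions of `t`, `ϱ² = x₀² + x₁²` and `x₃²`, equal to `1`
for `t ≥ -71/20 > -(15/8)²`, `81/1024 ≤ ϱ² ≤ 529/64`, `x₃² ≤ 225/64` (so on `Q̃½`) and vanishing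
for `t ≤ -15/4` or `ϱ² ≤ 72/1024` or `ϱ² ≥ 35/4` or `x₃² ≥ 961/256` (so off a compact subset of
`𝒞̃`). Any other choice would do. [cite: SereginZajaczkowski2007, proof of Lemma 4.2 (the cut-off ψ)] -/
def lemma42Cutoff (t : ℝ) (x : ℝ³) : ℝ :=
  Real.smoothTransition (5 * t + 75 / 4) *
    (Real.smoothTransition ((1024 * cylRadius x ^ 2 - 72) / 9) *
      Real.smoothTransition ((560 - 64 * cylRadius x ^ 2) / 31) *
      Real.smoothTransition ((961 - 256 * x 2 ^ 2) / 61))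

/-- The compact set `K₀ = {72/1024 ≤ ϱ² ≤ 35/4, x₃² ≤ 961/256} ⊂ 𝒞̃` off which the explicit
cut-off vanishes. [folklore] -/
def lemma42CutoffSupport : Set ℝ³ :=
  {x | 72 / 1024 ≤ cylRadius x ^ 2 ∧ cylRadius x ^ 2 ≤ 35 / 4 ∧ x 2 ^ 2 ≤ 961 / 256}

/-- `K₀` is compact (closed and inside the ball of radius `4`). [folklore] -/
theorem isCompact_lemma42CutoffSupport : IsCompact lemma42CutoffSupport := by
  have hρ2 : Continuous fun x : ℝ³ => cylRadius x ^ 2 := continuous_cylRadius.pow 2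
  have hx2 : Continuous fun x : ℝ³ => x 2 ^ 2 := (EuclideanSpace.proj (2 : Fin 3)).continuous.pow 2
  have hclosed : IsClosed lemma42CutoffSupport :=
    (isClosed_le continuous_const hρ2).inter
      ((isClosed_le hρ2 continuous_const).inter (isClosed_le hx2 continuous_const))
  refine (isCompact_closedBall (0 : ℝ³) 4).of_isClosed_subset hclosed fun x hx => ?_
  obtain ⟨-, h2, h3⟩ := hx
  rw [mem_closedBall, dist_zero_right, EuclideanSpace.norm_eq]
  have hsum : ∑ i, ‖x i‖ ^ 2 = cylRadius x ^ 2 + x 2 ^ 2 := by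
    simp only [Fin.sum_univ_three, Real.norm_eq_abs, sq_abs, cylRadius_sq]
  rw [hsum]
  calc Real.sqrt (cylRadius x ^ 2 + x 2 ^ 2) ≤ Real.sqrt (4 ^ 2) :=
        Real.sqrt_le_sqrt (by linarith)
    _ = 4 := Real.sqrt_sq (by norm_num)

/-- `K₀ ⊂ 𝒞̃ = 𝒞(1/4, 3; 2)`. [folklore] -/
theorem lemma42CutoffSupport_subset : lemma42CutoffSupport ⊆ shell (1 / 4) 3 2 := by
  intro x hx
  obtain ⟨h1, h2, h3⟩ := hx
  have hρ := cylRadius_nonneg x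
  rw [mem_shell]
  refine ⟨⟨?_, ?_⟩, ?_⟩
  · nlinarith
  · nlinarith
  · exact abs_lt_of_sq_lt_sq (by linarith) (by norm_num)

/-- **The explicit cut-off is a cut-off of the class `IsLemma42Cutoff`.** [folklore] -/
theorem isLemma42Cutoff_lemma42Cutoff : IsLemma42Cutoff lemma42Cutoff where
  contDiff := by
    have h2 : ContDiff ℝ ∞ fun p : ℝ × ℝ³ => p.2 2 := contDiff_euclidean.mp contDiff_snd 2
    have hρ : ContDiff ℝ ∞ fun p : ℝ × ℝ³ => cylRadius p.2 ^ 2 := by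
      have h0 : ContDiff ℝ ∞ fun p : ℝ × ℝ³ => p.2 0 := contDiff_euclidean.mp contDiff_snd 0
      have h1 : ContDiff ℝ ∞ fun p : ℝ × ℝ³ => p.2 1 := contDiff_euclidean.mp contDiff_snd 1
      have heq : (fun p : ℝ × ℝ³ => cylRadius p.2 ^ 2) = fun p => p.2 0 ^ 2 + p.2 1 ^ 2 :=
        funext fun p => cylRadius_sq p.2
      rw [heq]
      exact (h0.pow 2).add (h1.pow 2)
    have hS : ContDiff ℝ ∞ Real.smoothTransition := Real.smoothTransition.contDiff
    have hT : ContDiff ℝ ∞ fun p : ℝ × ℝ³ => Real.smoothTransition (5 * p.1 + 75 / 4) :=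
      hS.comp ((contDiff_const.mul contDiff_fst).add contDiff_const)
    have hR₁ : ContDiff ℝ ∞ fun p : ℝ × ℝ³ =>
        Real.smoothTransition ((1024 * cylRadius p.2 ^ 2 - 72) / 9) :=
      hS.comp (((contDiff_const.mul hρ).sub contDiff_const).div_const _)
    have hR₂ : ContDiff ℝ ∞ fun p : ℝ × ℝ³ =>
        Real.smoothTransition ((560 - 64 * cylRadius p.2 ^ 2) / 31) :=
      hS.comp ((contDiff_const.sub (contDiff_const.mul hρ)).div_const _)
    have hZ : ContDiff ℝ ∞ fun p : ℝ × ℝ³ => Real.smoothTransition ((961 - 256 * p.2 2 ^ 2) / 61) :=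
      hS.comp ((contDiff_const.sub (contDiff_const.mul (h2.pow 2))).div_const _)
    exact hT.mul ((hR₁.mul hR₂).mul hZ)
  nonneg t x := by
    unfold lemma42Cutoff
    have h0 := Real.smoothTransition.nonneg
    exact mul_nonneg (h0 _) (mul_nonneg (mul_nonneg (h0 _) (h0 _)) (h0 _))
  le_one t x := by
    unfold lemma42Cutoff
    have h0 := Real.smoothTransition.nonneg
    have h1 := Real.smoothTransition.le_one
    refine mul_le_one₀ (h1 _) (mul_nonneg (mul_nonneg (h0 _) (h0 _)) (h0 _)) ?_
    exact mul_le_one₀ (mul_le_one₀ (h1 _) (h0 _) (h1 _)) (h0 _) (h1 _)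
  isAxisymmetricScalar t θ x := by
    simp only [lemma42Cutoff, cylRadius_rotZ, rotZ_apply_two]
  eq_one z hz := by
    rw [mem_shellCyl] at hz
    obtain ⟨⟨ht, -⟩, ⟨hρ1, hρ2⟩, h3⟩ := hz
    have hρ := cylRadius_nonneg z.2
    have hsq : z.2 2 ^ 2 < (15 / 8) ^ 2 := by
      rw [← sq_abs]
      exact pow_lt_pow_left₀ h3 (abs_nonneg _) two_ne_zero
    unfold lemma42Cutoff
    rw [Real.smoothTransition.one_of_one_le, Real.smoothTransition.one_of_one_le,
      Real.smoothTransition.one_of_one_le, Real.smoothTransition.one_of_one_le]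
    · norm_num
    · rw [le_div_iff₀ (by norm_num)]
      nlinarith
    · rw [le_div_iff₀ (by norm_num)]
      nlinarith
    · rw [le_div_iff₀ (by norm_num)]
      nlinarith
    · nlinarith
  support := by
    refine ⟨lemma42CutoffSupport, isCompact_lemma42CutoffSupport, lemma42CutoffSupport_subset,
      -15 / 4, ⟨by norm_num, by norm_num⟩, fun t x h => ?_⟩
    unfold lemma42Cutoff
    rcases h with hx | ht
    · simp only [lemma42CutoffSupport, mem_setOf_eq, not_and_or, not_le] at hx
      rcases hx with h1 | h2 | h3
      · rw [Real.smoothTransition.zero_of_nonpos (x := (1024 * cylRadius x ^ 2 - 72) / 9)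
          (by rw [div_nonpos_iff]; right; constructor <;> nlinarith)]
        ring
      · rw [Real.smoothTransition.zero_of_nonpos (x := (560 - 64 * cylRadius x ^ 2) / 31)
          (by rw [div_nonpos_iff]; right; constructor <;> nlinarith)]
        ring
      · rw [Real.smoothTransition.zero_of_nonpos (x := (961 - 256 * x 2 ^ 2) / 61)
          (by rw [div_nonpos_iff]; right; constructor <;> nlinarith)]
        ring
    · rw [Real.smoothTransition.zero_of_nonpos (x := 5 * t + 75 / 4) (by linarith)]
      ring

/-! ### Grönwall's lemma on a general time interval -/

/-- **Grönwall's lemma in integral form with an `L¹` kernel, on `[T₀, T₁]`**: if `φ ≤ M < ∞` on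
`[T₀, T₁]`, `∫_{]T₀,T₁[} a < ∞`, `B < ∞` and `φ(t) ≤ B + ∫_{]T₀,t[} a φ` for all `t ∈ [T₀, T₁]`,
then `φ(t) ≤ B exp (∫_{]T₀,t[} a)` on `[T₀, T₁]` (the accepted `lintegral_gronwall_le`,
Robinson–Rodrigo–Sadowski 2016, Lemma A.25, is the case `T₀ = 0`; translate time by `T₀`).
[cite: RobinsonRodrigoSadowski2016, Lemma A.25] -/
theorem lintegral_gronwall_le_of_Icc {T₀ T₁ : ℝ} {φ a : ℝ → ℝ≥0∞} {B M : ℝ≥0∞} (hB : B ≠ ⊤)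
    (hM : M ≠ ⊤) (hφM : ∀ t ∈ Icc T₀ T₁, φ t ≤ M) (ha : ∫⁻ t in Ioo T₀ T₁, a t ≠ ⊤)
    (hφ : ∀ t ∈ Icc T₀ T₁, φ t ≤ B + ∫⁻ s in Ioo T₀ t, a s * φ s) :
    ∀ t ∈ Icc T₀ T₁, φ t ≤ B * ENNReal.ofReal (Real.exp (∫⁻ s in Ioo T₀ t, a s).toReal) := by
  -- translation of set integrals by `T₀`
  have hshift : ∀ (g : ℝ → ℝ≥0∞) (τ : ℝ),
      ∫⁻ s in Ioo 0 τ, g (T₀ + s) = ∫⁻ s in Ioo T₀ (T₀ + τ), g s := by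
    intro g τ
    have hmp : MeasurePreserving (fun s : ℝ => T₀ + s) volume volume :=
      measurePreserving_add_left volume T₀
    have hemb : MeasurableEmbedding fun s : ℝ => T₀ + s :=
      (Homeomorph.addLeft T₀).measurableEmbedding
    have h := hmp.setLIntegral_comp_preimage_emb hemb g (Ioo T₀ (T₀ + τ))
    rwa [Set.preimage_const_add_Ioo, sub_self, add_sub_cancel_left] at h
  intro t ht
  have key := lintegral_gronwall_le (S := T₁ - T₀) (φ := fun τ => φ (T₀ + τ))
    (a := fun τ => a (T₀ + τ)) (B := B) (M := M) hB hM ?_ ?_ ?_ (t - T₀)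
    ⟨sub_nonneg.2 ht.1, sub_le_sub_right ht.2 _⟩
  · rwa [hshift a (t - T₀), add_sub_cancel] at key
  · intro τ hτ
    exact hφM (T₀ + τ) ⟨by linarith [hτ.1], by linarith [hτ.2]⟩
  · rw [hshift a (T₁ - T₀), add_sub_cancel]
    exact ha
  · intro τ hτ
    have h := hφ (T₀ + τ) ⟨by linarith [hτ.1], by linarith [hτ.2]⟩
    rwa [← hshift (fun s => a s * φ s) τ] at h

/-! ### Step 3 (proved): the vorticity bound from (4.5) and (4.13) by Grönwall's lemma -/

/-- **Tonelli for the kernel**: `∫_{]-2²,0[} ∫_𝒞̃ |∇V|² dx ds = ∫_Q̃ |∇V|² dz ≤ 𝒜₂` for the class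
(the classical gradient is continuous on `Q̃`, hence measurable there).
[cite: SereginZajaczkowski2007, Prop. 4.1 (the functional 𝒜₂, the term ∫_Q̃ |∇V|²)] -/
theorem IsSmoothAxisymmetricSolutionOn.lintegral_shellGradEnergy_le {V : ℝ → ℝ³ → ℝ³}
    {P : ℝ → ℝ³ → ℝ} (hV : IsSmoothAxisymmetricSolutionOn (shellCylOpens (1 / 4) 3 2 2) V P) :
    ∫⁻ s in Ioo (-(2 : ℝ) ^ 2) 0, shellGradEnergy V s ≤ szEnergy V P fun t x => fderiv ℝ (V t) x := by
  set F : ℝ × ℝ³ → ℝ≥0∞ := fun z => ENNReal.ofReal (frobeniusNormSq (fderiv ℝ (V z.1) z.2))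
    with hF
  have hFc : ContinuousOn F (shellCyl (1 / 4) 3 2 2) := by
    have h := hV.continuousOn_fderiv
    rw [coe_shellCylOpens] at h
    exact ENNReal.continuous_ofReal.comp_continuousOn (continuous_frobeniusNormSq.comp_continuousOn h)
  have hFm : AEMeasurable F ((volume.restrict (Ioo (-(2 : ℝ) ^ 2) 0)).prod
      (volume.restrict (shell (1 / 4) 3 2))) := by
    rw [Measure.prod_restrict, ← Measure.volume_eq_prod, ← shellCyl_eq_prod]
    exact hFc.aemeasurable (measurableSet_shellCyl _ _ _ _)
  have hT : ∫⁻ z in shellCyl (1 / 4) 3 2 2, F z =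
      ∫⁻ s in Ioo (-(2 : ℝ) ^ 2) 0, ∫⁻ x in shell (1 / 4) 3 2, F (s, x) := by
    rw [shellCyl_eq_prod, Measure.volume_eq_prod, ← Measure.prod_restrict]
    exact lintegral_prod F hFm
  calc ∫⁻ s in Ioo (-(2 : ℝ) ^ 2) 0, shellGradEnergy V s
      = ∫⁻ z in shellCyl (1 / 4) 3 2 2, F z := hT.symm
    _ ≤ szEnergy V P fun t x => fderiv ℝ (V t) x := by
        rw [← outerShell_one_eq]
        unfold szEnergy
        exact le_add_right (le_add_right le_add_self)

/-- On `Q̃½` the cut-offs equal `1` and `ϱ < 3`, so `|ω_φ|² ≤ 9 |χ̃/ϱ|²` pointwise and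
`∫_{𝒞½} |ω_φ(·,t)|² ≤ 9 y(t)`, `-(15/8)² < t < 0`.
[cite: SereginZajaczkowski2007, proof of Lemma 4.2 ("‖χ̃‖_{L_{2,∞}(Q̃)} ≤ Φ₃(𝒜₂)" on Q̃₁)] -/
theorem setLIntegral_angularVorticity_sq_le_vortEnergy {ψ : ℝ → ℝ³ → ℝ} (hψ : IsLemma42Cutoff ψ)
    (V : ℝ → ℝ³ → ℝ³) {t : ℝ} (ht : t ∈ Ioo (-(15 / 8 : ℝ) ^ 2) 0) :
    ∫⁻ x in shell (9 / 32) (23 / 8) (15 / 8), ‖angularVorticity (V t) x‖ₑ ^ 2 ≤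
      9 * vortEnergy ψ V t := by
  have hpt : ∀ x ∈ shell (9 / 32) (23 / 8) (15 / 8), ‖angularVorticity (V t) x‖ₑ ^ 2 ≤
      9 * ‖angularVorticity (V t) x * ψ t x / cylRadius x‖ₑ ^ 2 := by
    intro x hx
    have h1 : ψ t x = 1 := hψ.eq_one (t, x) ⟨ht, hx⟩
    rw [mem_shell] at hx
    have hρ0 : 0 < cylRadius x := lt_trans (by norm_num) hx.1.1
    have hρ3 : cylRadius x ^ 2 ≤ 9 := by nlinarith [hx.1.2, cylRadius_nonneg x]
    set χ := angularVorticity (V t) x with hχ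
    have hreal : χ ^ 2 ≤ 9 * (χ * ψ t x / cylRadius x) ^ 2 := by
      rw [h1, mul_one]
      have : χ ^ 2 = (χ / cylRadius x) ^ 2 * cylRadius x ^ 2 := by
        field_simp
      rw [this, mul_comm]
      gcongr
    calc ‖χ‖ₑ ^ 2 = ENNReal.ofReal (χ ^ 2) := by
          rw [Real.enorm_eq_ofReal_abs, ← ENNReal.ofReal_pow (abs_nonneg _), sq_abs]
      _ ≤ ENNReal.ofReal (9 * (χ * ψ t x / cylRadius x) ^ 2) := ENNReal.ofReal_le_ofReal hreal
      _ = 9 * ‖χ * ψ t x / cylRadius x‖ₑ ^ 2 := by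
          rw [ENNReal.ofReal_mul (by norm_num), ENNReal.ofReal_ofNat, Real.enorm_eq_ofReal_abs,
            ← ENNReal.ofReal_pow (abs_nonneg _), sq_abs]
  calc ∫⁻ x in shell (9 / 32) (23 / 8) (15 / 8), ‖angularVorticity (V t) x‖ₑ ^ 2
      ≤ ∫⁻ x in shell (9 / 32) (23 / 8) (15 / 8),
          9 * ‖angularVorticity (V t) x * ψ t x / cylRadius x‖ₑ ^ 2 :=
        setLIntegral_mono' (isOpen_shell _ _ _).measurableSet hpt
    _ = 9 * ∫⁻ x in shell (9 / 32) (23 / 8) (15 / 8),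
          ‖angularVorticity (V t) x * ψ t x / cylRadius x‖ₑ ^ 2 :=
        lintegral_const_mul' _ _ (by norm_num)
    _ ≤ 9 * vortEnergy ψ V t := by
        unfold vortEnergy
        gcongr
        exact shell_half_subset_tilde

/-- Before the time `t₀` of a cut-off the localized enstrophy vanishes: `y(-2²) = 0`. [folklore] -/
theorem vortEnergy_bot_eq_zero {ψ : ℝ → ℝ³ → ℝ} (hψ : IsLemma42Cutoff ψ) (V : ℝ → ℝ³ → ℝ³) :
    vortEnergy ψ V (-(2 : ℝ) ^ 2) = 0 := by
  obtain ⟨K₀, -, -, t₀, ht₀, hzero⟩ := hψ.support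
  have h0 : ∀ x, ψ (-(2 : ℝ) ^ 2) x = 0 := fun x => hzero _ x (Or.inr ht₀.1.le)
  unfold vortEnergy
  simp only [h0, mul_zero, zero_div, enorm_zero, ne_eq, OfNat.ofNat_ne_zero, not_false_eq_true,
    zero_pow, lintegral_const, zero_mul]

/-- **Seregin–Zajaczkowski 2007, first half of the proof of Lemma 4.2, proved from (4.5) and
(4.13)** ("Estimate (4.13) implies `‖χ̃‖_{L_{2,∞}(Q̃)} ≤ Φ₃(𝒜₂)`"): feed the explicit cut-off
`lemma42Cutoff` to (4.13) (`LocalizedVorticityEnergyInequality`, with (4.5) supplied by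
`AngularVorticityEquation`); since `y(-2²) = 0`, Grönwall's lemma (`lintegral_gronwall_le_of_Icc`)
gives `1 + y(t) ≤ exp (∫_{-2²}^{t} C(1+K)²(1 + ∫_𝒞̃|∇V|²)) ≤ exp (C(1+K)²(4+K))` because
`∫_{-2²}^{0} ∫_𝒞̃ |∇V|² = ∫_Q̃ |∇V|² ≤ 𝒜₂ ≤ K` (Tonelli, `lintegral_shellGradEnergy_le`); and on `Q̃½`,
`∫_{𝒞½} |ω_φ|² ≤ 9 y(t)` (`setLIntegral_angularVorticity_sq_le_vortEnergy`). Hence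
`OffAxisVorticityL2Bound` with `Φ₃(K) = 9 exp (C(1+K)²(4+K))`, non-decreasing.
[cite: SereginZajaczkowski2007, proof of Lemma 4.2 ("Estimate (4.13) implies ‖χ̃‖_{L_{2,∞}(Q̃)} ≤ Φ₃(𝒜₂)")] -/
theorem offAxisVorticityL2Bound_of (h1 : AngularVorticityEquation)
    (h2 : LocalizedVorticityEnergyInequality) : OffAxisVorticityL2Bound := by
  obtain ⟨C, hC⟩ := h2 lemma42Cutoff isLemma42Cutoff_lemma42Cutoff
  refine ⟨fun K => 9 * Real.toNNReal (Real.exp ((C * (1 + K) ^ 2 * (4 + K) : ℝ≥0) : ℝ)), ?_, ?_⟩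
  · intro K K' hKK'
    have h : C * (1 + K) ^ 2 * (4 + K) ≤ C * (1 + K') ^ 2 * (4 + K') := by gcongr
    exact mul_le_mul_right (Real.toNNReal_le_toNNReal
      (Real.exp_le_exp.2 (NNReal.coe_le_coe.2 h))) 9
  intro V P hV K hK t ht
  obtain ⟨hbdd, hineq⟩ := hC V P hV (h1 V P hV) K hK
  have h4 : (-(2 : ℝ) ^ 2) = -4 := by norm_num
  have ht4 : t ∈ Ioo (-(2 : ℝ) ^ 2) 0 := ⟨by rw [h4]; nlinarith [ht.1], ht.2⟩
  -- (i) the kernel: `∫_{-4}^{t} C(1+K)²(1 + ∫_𝒞̃|∇V|²) ≤ C(1+K)²(4+K)`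
  have hIa : ∫⁻ s in Ioo (-(2 : ℝ) ^ 2) t, (C : ℝ≥0∞) * (1 + K) ^ 2 * (1 + shellGradEnergy V s) ≤
      ((C * (1 + K) ^ 2 * (4 + K) : ℝ≥0) : ℝ≥0∞) := by
    have hB : ∫⁻ s in Ioo (-(2 : ℝ) ^ 2) t, shellGradEnergy V s ≤ K :=
      (lintegral_mono_set (Ioo_subset_Ioo le_rfl ht4.2.le)).trans
        (hV.lintegral_shellGradEnergy_le.trans hK)
    have hvol : volume (Ioo (-(2 : ℝ) ^ 2) t) ≤ 4 := by
      rw [Real.volume_Ioo, ← ENNReal.ofReal_ofNat]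
      exact ENNReal.ofReal_le_ofReal (by rw [h4]; linarith [ht4.2])
    calc ∫⁻ s in Ioo (-(2 : ℝ) ^ 2) t, (C : ℝ≥0∞) * (1 + K) ^ 2 * (1 + shellGradEnergy V s)
        = (C : ℝ≥0∞) * (1 + K) ^ 2 * ∫⁻ s in Ioo (-(2 : ℝ) ^ 2) t, (1 + shellGradEnergy V s) :=
          lintegral_const_mul' _ _ (by finiteness)
      _ = (C : ℝ≥0∞) * (1 + K) ^ 2 *
            (volume (Ioo (-(2 : ℝ) ^ 2) t) + ∫⁻ s in Ioo (-(2 : ℝ) ^ 2) t, shellGradEnergy V s) := by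
          rw [lintegral_add_left' aemeasurable_const, setLIntegral_const, one_mul]
      _ ≤ (C : ℝ≥0∞) * (1 + K) ^ 2 * (4 + K) := by gcongr
      _ = ((C * (1 + K) ^ 2 * (4 + K) : ℝ≥0) : ℝ≥0∞) := by push_cast; ring
  -- (ii) Grönwall for `1 + y` on `[-4, t]`
  obtain ⟨M, hM⟩ := hbdd t ht4
  have hy0 := vortEnergy_bot_eq_zero isLemma42Cutoff_lemma42Cutoff V
  have hG := lintegral_gronwall_le_of_Icc (T₀ := -(2 : ℝ) ^ 2) (T₁ := t)
    (φ := fun s => 1 + vortEnergy lemma42Cutoff V s)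
    (a := fun s => (C : ℝ≥0∞) * (1 + K) ^ 2 * (1 + shellGradEnergy V s)) (B := 1) (M := 1 + M)
    ENNReal.one_ne_top (by finiteness) (fun s hs => add_le_add_right (hM s hs) 1)
    (ne_top_of_le_ne_top ENNReal.coe_ne_top hIa) ?_ t ⟨ht4.1.le, le_rfl⟩
  swap
  · intro s hs
    rcases eq_or_lt_of_le hs.1 with h | h
    · rw [← h, hy0, Ioo_self, Measure.restrict_empty, lintegral_zero_measure]
    · exact add_le_add_right (hineq s ⟨h, lt_of_le_of_lt hs.2 ht4.2⟩) 1
  simp only [one_mul] at hG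
  have htoReal : (∫⁻ s in Ioo (-(2 : ℝ) ^ 2) t, (C : ℝ≥0∞) * (1 + K) ^ 2 * (1 + shellGradEnergy V s)).toReal
      ≤ ((C * (1 + K) ^ 2 * (4 + K) : ℝ≥0) : ℝ) := by
    have h := ENNReal.toReal_mono ENNReal.coe_ne_top hIa
    rwa [ENNReal.coe_toReal] at h
  -- (iii) assembling on `Q̃½`
  calc ∫⁻ x in shell (9 / 32) (23 / 8) (15 / 8), ‖angularVorticity (V t) x‖ₑ ^ 2
      ≤ 9 * vortEnergy lemma42Cutoff V t :=
        setLIntegral_angularVorticity_sq_le_vortEnergy isLemma42Cutoff_lemma42Cutoff V ht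
    _ ≤ 9 * (1 + vortEnergy lemma42Cutoff V t) := by gcongr; exact le_add_self
    _ ≤ 9 * ENNReal.ofReal (Real.exp
          (∫⁻ s in Ioo (-(2 : ℝ) ^ 2) t, (C : ℝ≥0∞) * (1 + K) ^ 2 * (1 + shellGradEnergy V s)).toReal) := by
        gcongr
    _ ≤ 9 * ENNReal.ofReal (Real.exp ((C * (1 + K) ^ 2 * (4 + K) : ℝ≥0) : ℝ)) := by
        gcongr
    _ = ((9 * Real.toNNReal (Real.exp ((C * (1 + K) ^ 2 * (4 + K) : ℝ≥0) : ℝ)) : ℝ≥0) : ℝ≥0∞) := by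
        rw [ENNReal.coe_mul]
        rfl

end SereginZajaczkowski2007

end Literature.Analysis.FluidPDE
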